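import Mathlib
import Literature.Probability.LatticeModels.ThermodynamicLimit
import Summits.CriticalPhenomena.Ising3DConformalLimit.Theorems.PrecisionLaplacianTwoPointSpineGlueLattice
import HarnessLib

/-!
# TwoPointSpineGlue (route PrecisionLaplacian, item stmt-CriticalPhenomena-4805) — heavy boxes and the
# upper envelope from the TAIL profile

Helper file 6.  Let `a : ℤ³ → ℝ` satisfy the route's TAIL statement in vector form,
`a(x)‖x‖₂^r − Φ(x/‖x‖₂) → 0` at infinity, with `Φ` continuous on the unit sphere.

* `heavyBoxes_of_profile` — if moreover `Φ(w₀) > 0` at one unit vector, then there are `c > 0`, `L₀ ≥ 1`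
  and lattice centres `c_L = L·⌊M w₀⌋` such that for every `L ≥ L₀` the box `c_L + Λ_L` avoids the
  origin and carries `a ≥ c L^{-r}` (these boxes lie in a narrow cone around `w₀`, far out);
* `upper_of_profile` — `a(x) ≤ C ‖x‖_∞^{-r}` for all `x ≠ 0`;
* helpers `norm_normalize_sub_normalize_le` (directions are Lipschitz) and `norm_le_norm_siteVec`.

These feed the symbol lower bound `…TwoPointSpineGlueSymbol.psi_lower_of_boxes` and the two-sided
`η`-bounds.  No definitions are introduced.
-/

noncomputable section

namespace Summit.CriticalPhenomena.Ising3DConformalLimit.Theorems.SpineGlue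

open Finset Real Filter Topology Literature.Probability.LatticeModels

section HeavyBoxes

/-- Directions are Lipschitz: `‖p/‖p‖ − q/‖q‖‖ ≤ 2‖p − q‖/‖q‖` for `q ≠ 0`, `p ≠ 0`. -/
theorem norm_normalize_sub_normalize_le {E : Type*} [NormedAddCommGroup E] [NormedSpace ℝ E]
    {p q : E} (hp : p ≠ 0) (hq : q ≠ 0) :
    ‖‖p‖⁻¹ • p - ‖q‖⁻¹ • q‖ ≤ 2 * ‖p - q‖ / ‖q‖ := by
  have hpn : 0 < ‖p‖ := norm_pos_iff.2 hp
  have hqn : 0 < ‖q‖ := norm_pos_iff.2 hq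
  -- `p/‖p‖ - q/‖q‖ = (p - q)/‖q‖ + p (1/‖p‖ - 1/‖q‖)`
  have hdecomp : ‖p‖⁻¹ • p - ‖q‖⁻¹ • q = ‖q‖⁻¹ • (p - q) + (‖p‖⁻¹ - ‖q‖⁻¹) • p := by
    rw [smul_sub, sub_smul]; abel
  rw [hdecomp]
  have h1 : ‖‖q‖⁻¹ • (p - q)‖ = ‖p - q‖ / ‖q‖ := by
    rw [norm_smul, norm_inv, norm_norm, div_eq_inv_mul]
  have h2 : ‖(‖p‖⁻¹ - ‖q‖⁻¹) • p‖ ≤ ‖p - q‖ / ‖q‖ := by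
    rw [norm_smul, Real.norm_eq_abs]
    have h3 : |‖p‖⁻¹ - ‖q‖⁻¹| * ‖p‖ = |‖q‖ - ‖p‖| / ‖q‖ := by
      rw [inv_sub_inv hpn.ne' hqn.ne', abs_div, abs_of_pos (mul_pos hpn hqn)]
      field_simp
    rw [h3]
    apply div_le_div_of_nonneg_right _ hqn.le
    rw [abs_sub_comm]
    exact abs_norm_sub_norm_le p q
  calc ‖‖q‖⁻¹ • (p - q) + (‖p‖⁻¹ - ‖q‖⁻¹) • p‖
      ≤ ‖‖q‖⁻¹ • (p - q)‖ + ‖(‖p‖⁻¹ - ‖q‖⁻¹) • p‖ := norm_add_le _ _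
    _ ≤ ‖p - q‖ / ‖q‖ + ‖p - q‖ / ‖q‖ := by rw [h1]; exact add_le_add le_rfl h2
    _ = 2 * ‖p - q‖ / ‖q‖ := by ring

/-- **Heavy boxes from the TAIL profile** (`d = 3`).  If `a(x)‖x‖₂^r − Φ(x̂) → 0` at infinity with
`Φ` continuous on the unit sphere and `Φ(w₀) > 0` at a unit vector `w₀`, then there are `c > 0`,
`L₀ ≥ 1` and lattice centres `c_L` such that the box `c_L + Λ_L` avoids the origin and `a ≥ c L^{-r}` on
it, for every `L ≥ L₀` (take `c_L = L·⌊M w₀⌋` with `M` large: these boxes lie in a narrow cone around `w₀`,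
far out). -/
theorem heavyBoxes_of_profile {a : Site 3 → ℝ} {r : ℝ} (hr : 0 ≤ r) {Φ : EuclideanSpace ℝ (Fin 3) → ℝ}
    (hΦc : ContinuousOn Φ (Metric.sphere 0 1)) {w₀ : EuclideanSpace ℝ (Fin 3)} (hw₀ : ‖w₀‖ = 1)
    (hΦw₀ : 0 < Φ w₀)
    (hT : Tendsto (fun x : Site 3 => a x * ‖siteVec x‖ ^ r - Φ (‖siteVec x‖⁻¹ • siteVec x))
      cofinite (𝓝 0)) :
    ∃ (c : ℝ) (L₀ : ℕ) (ctr : ℕ → Site 3), 0 < c ∧ 1 ≤ L₀ ∧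
      ∀ L : ℕ, L₀ ≤ L → ∀ u ∈ box 3 L, ctr L + u ≠ 0 ∧ c * (L : ℝ) ^ (-r) ≤ a (ctr L + u) := by
  have hw₀0 : w₀ ≠ 0 := by
    intro h; rw [h, norm_zero] at hw₀; exact zero_ne_one hw₀
  set c₀ : ℝ := Φ w₀ / 4 with hc₀
  have hc₀pos : 0 < c₀ := by positivity
  -- continuity of `Φ` at `w₀` on the sphere
  have hw₀s : w₀ ∈ Metric.sphere (0 : EuclideanSpace ℝ (Fin 3)) 1 := by simp [hw₀]
  obtain ⟨ρ, hρ, hΦnear⟩ : ∃ ρ > 0, ∀ u ∈ Metric.sphere (0 : EuclideanSpace ℝ (Fin 3)) 1,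
      dist u w₀ < ρ → 2 * c₀ < Φ u := by
    have h := (hΦc w₀ hw₀s)
    rw [Metric.continuousWithinAt_iff] at h
    obtain ⟨ρ, hρ, h⟩ := h (Φ w₀ / 2) (by positivity)
    refine ⟨ρ, hρ, fun u hu hd => ?_⟩
    have := h hu hd
    rw [Real.dist_eq] at this
    have := (abs_lt.1 this).1
    simp only [hc₀]; linarith
  -- the centre direction `m₀ = ⌊M w₀⌋`, `M` large
  obtain ⟨M, hM8, hM5⟩ : ∃ M : ℕ, 8 / ρ < (M : ℝ) ∧ (8 : ℝ) ≤ M := by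
    obtain ⟨M, hM⟩ := exists_nat_gt (max (8 / ρ) 8)
    exact ⟨M, lt_of_le_of_lt (le_max_left _ _) hM, (le_max_right _ _).trans hM.le⟩
  have hMpos : (0 : ℝ) < M := by linarith
  set m₀ : Site 3 := latticeApprox ((M : ℝ)⁻¹) w₀ with hm₀
  have hm₀M : ‖siteVec m₀ - (M : ℝ) • w₀‖ ≤ 2 := norm_siteVec_latticeApprox_sub_le M w₀
  -- every point of `L • m₀ + Λ_L` is `L • p` with `‖p − M w₀‖ ≤ 4`
  have hbox_dir : ∀ (L : ℕ), 1 ≤ L → ∀ u ∈ box 3 L,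
      ‖siteVec ((L : ℤ) • m₀ + u) - ((L : ℝ) * M) • w₀‖ ≤ 4 * L := by
    intro L hL u hu
    have hL0 : (0 : ℝ) ≤ L := Nat.cast_nonneg L
    have hu2 : ‖siteVec u‖ ≤ 2 * L := by
      rw [EuclideanSpace.norm_eq]
      have hcoord : ∀ j, ‖(siteVec u) j‖ ^ 2 ≤ (L : ℝ) ^ 2 := fun j => by
        rw [siteVec_apply, Real.norm_eq_abs, sq_abs]
        have := (mem_box.1 hu) j
        have h1 : |((u j : ℤ) : ℝ)| ≤ L := by
          rw [abs_le]; exact ⟨by exact_mod_cast this.1, by exact_mod_cast this.2⟩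
        nlinarith [abs_nonneg ((u j : ℤ) : ℝ), sq_abs ((u j : ℤ) : ℝ)]
      calc Real.sqrt (∑ j, ‖(siteVec u) j‖ ^ 2) ≤ Real.sqrt (3 * (L : ℝ) ^ 2) := by
            apply Real.sqrt_le_sqrt
            calc ∑ j, ‖(siteVec u) j‖ ^ 2 ≤ ∑ _j : Fin 3, (L : ℝ) ^ 2 := Finset.sum_le_sum fun j _ => hcoord j
              _ = 3 * (L : ℝ) ^ 2 := by simp
        _ ≤ 2 * L := by
            rw [Real.sqrt_le_left (by positivity)]
            nlinarith
    have hsv : siteVec ((L : ℤ) • m₀ + u) = (L : ℝ) • siteVec m₀ + siteVec u := by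
      ext j; simp [siteVec_apply]
    rw [hsv, show (L : ℝ) • siteVec m₀ + siteVec u - ((L : ℝ) * M) • w₀
        = (L : ℝ) • (siteVec m₀ - (M : ℝ) • w₀) + siteVec u by rw [mul_smul, smul_sub]; abel]
    calc ‖(L : ℝ) • (siteVec m₀ - (M : ℝ) • w₀) + siteVec u‖
        ≤ ‖(L : ℝ) • (siteVec m₀ - (M : ℝ) • w₀)‖ + ‖siteVec u‖ := norm_add_le _ _
      _ ≤ L * 2 + 2 * L := by
          rw [norm_smul, Real.norm_natCast]
          exact add_le_add (mul_le_mul_of_nonneg_left hm₀M hL0) hu2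
      _ = 4 * L := by ring
  -- consequences: norm between `L(M-4)` and `L(M+4)`, direction within `ρ` of `w₀`
  have hbox_norm : ∀ (L : ℕ), 1 ≤ L → ∀ u ∈ box 3 L,
      (L : ℝ) * (M - 4) ≤ ‖siteVec ((L : ℤ) • m₀ + u)‖ ∧ ‖siteVec ((L : ℤ) • m₀ + u)‖ ≤ (L : ℝ) * (M + 4) := by
    intro L hL u hu
    have h := hbox_dir L hL u hu
    have hq : ‖((L : ℝ) * M) • w₀‖ = L * M := by
      rw [norm_smul, hw₀, mul_one, Real.norm_eq_abs, abs_of_nonneg (by positivity)]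
    constructor
    · have := norm_sub_norm_le (((L : ℝ) * M) • w₀) (siteVec ((L : ℤ) • m₀ + u))
      rw [hq, norm_sub_rev] at this
      linarith
    · have := norm_le_insert' (siteVec ((L : ℤ) • m₀ + u)) (((L : ℝ) * M) • w₀)
      rw [hq] at this
      have h' : ‖siteVec ((L : ℤ) • m₀ + u) - ((L : ℝ) * M) • w₀‖ ≤ 4 * L := h
      have := norm_le_of_mem_closedBall (show siteVec ((L : ℤ) • m₀ + u) ∈
        Metric.closedBall (((L : ℝ) * M) • w₀) (4 * L) from mem_closedBall_iff_norm.2 h')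
      calc ‖siteVec ((L : ℤ) • m₀ + u)‖ ≤ ‖((L : ℝ) * M) • w₀‖ + 4 * L := by
            have := norm_le_norm_add_norm_sub' (siteVec ((L : ℤ) • m₀ + u)) (((L : ℝ) * M) • w₀)
            linarith
        _ = L * (M + 4) := by rw [hq]; ring
  have hbox_sphere : ∀ (L : ℕ), 1 ≤ L → ∀ u ∈ box 3 L,
      dist (‖siteVec ((L : ℤ) • m₀ + u)‖⁻¹ • siteVec ((L : ℤ) • m₀ + u)) w₀ < ρ := by
    intro L hL u hu
    set p := siteVec ((L : ℤ) • m₀ + u) with hp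
    set q : EuclideanSpace ℝ (Fin 3) := ((L : ℝ) * M) • w₀ with hq
    have hL1 : (1 : ℝ) ≤ L := by exact_mod_cast hL
    have hqn : ‖q‖ = L * M := by
      rw [hq, norm_smul, hw₀, mul_one, Real.norm_eq_abs, abs_of_nonneg (by positivity)]
    have hq0 : q ≠ 0 := by
      intro h; rw [h, norm_zero] at hqn
      have : (0 : ℝ) < L * M := by positivity
      linarith
    have hp0 : p ≠ 0 := by
      intro h
      have := (hbox_norm L hL u hu).1
      rw [← hp, h, norm_zero] at this
      have : (0 : ℝ) < L * (M - 4) := by apply mul_pos (by positivity); linarith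
      linarith
    have hqdir : ‖q‖⁻¹ • q = w₀ := by
      rw [hqn, hq, smul_smul, inv_mul_cancel₀ (by positivity), one_smul]
    rw [dist_eq_norm, ← hqdir]
    calc ‖‖p‖⁻¹ • p - ‖q‖⁻¹ • q‖ ≤ 2 * ‖p - q‖ / ‖q‖ := norm_normalize_sub_normalize_le hp0 hq0
      _ ≤ 2 * (4 * L) / (L * M) := by
          rw [hqn]
          apply div_le_div_of_nonneg_right _ (by positivity)
          exact mul_le_mul_of_nonneg_left (hbox_dir L hL u hu) (by norm_num)
      _ = 8 / M := by field_simp; ring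
      _ < ρ := by rw [div_lt_iff₀ hMpos]; rw [div_lt_iff₀ hρ] at hM8; linarith
  -- TAIL eventually: beyond radius `R₀` the error is below `c₀`
  obtain ⟨R₀, hR₀⟩ : ∃ R₀ : ℝ, ∀ x : Site 3, R₀ ≤ ‖siteVec x‖ →
      |a x * ‖siteVec x‖ ^ r - Φ (‖siteVec x‖⁻¹ • siteVec x)| < c₀ := by
    have hev : ∀ᶠ x in cofinite, |a x * ‖siteVec x‖ ^ r - Φ (‖siteVec x‖⁻¹ • siteVec x)| < c₀ := by
      have := hT.eventually (Metric.ball_mem_nhds (0 : ℝ) hc₀pos)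
      filter_upwards [this] with x hx
      simpa [Real.dist_eq] using hx
    have hfin : Set.Finite {x : Site 3 | ¬ |a x * ‖siteVec x‖ ^ r - Φ (‖siteVec x‖⁻¹ • siteVec x)| < c₀} :=
      Filter.eventually_cofinite.1 hev
    obtain ⟨R, hR⟩ := (hfin.image fun x => ‖siteVec x‖).bddAbove
    refine ⟨R + 1, fun x hx => ?_⟩
    by_contra h
    have := hR (Set.mem_image_of_mem (fun x => ‖siteVec x‖) (show x ∈ {x : Site 3 | _} from h))
    linarith
  -- the scale threshold
  obtain ⟨L₀, hL₀⟩ := exists_nat_ge (max R₀ 1)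
  have hL₀1 : 1 ≤ L₀ := by
    have : (1 : ℝ) ≤ L₀ := (le_max_right _ _).trans hL₀
    exact_mod_cast this
  refine ⟨c₀ * ((M : ℝ) + 4) ^ (-r), L₀, fun L => (L : ℤ) • m₀, by positivity, hL₀1, ?_⟩
  intro L hL u hu
  have hL1 : 1 ≤ L := hL₀1.trans hL
  have hLpos : (0 : ℝ) < L := by exact_mod_cast hL1
  obtain ⟨hn1, hn2⟩ := hbox_norm L hL1 u hu
  set y := (L : ℤ) • m₀ + u with hy
  have hyn : 0 < ‖siteVec y‖ := lt_of_lt_of_le (by apply mul_pos hLpos; linarith) hn1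
  have hy0 : y ≠ 0 := fun h => by rw [h, siteVec_zero, norm_zero] at hyn; exact lt_irrefl 0 hyn
  refine ⟨hy0, ?_⟩
  have hyR : R₀ ≤ ‖siteVec y‖ := by
    have h1 : R₀ ≤ L₀ := (le_max_left _ _).trans hL₀
    have h2 : (L₀ : ℝ) ≤ L := by exact_mod_cast hL
    have h3 : (L : ℝ) ≤ L * (M - 4) := by nlinarith
    linarith
  have herr := hR₀ y hyR
  have hdir : 2 * c₀ < Φ (‖siteVec y‖⁻¹ • siteVec y) :=
    hΦnear _ (by simp [norm_smul, hyn.ne']) (hbox_sphere L hL1 u hu)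
  have hay : c₀ ≤ a y * ‖siteVec y‖ ^ r := by
    have := (abs_lt.1 herr).1
    linarith
  -- `a y ≥ c₀ ‖y‖^{-r} ≥ c₀ (L (M+4))^{-r}`
  have hpow : 0 < ‖siteVec y‖ ^ r := Real.rpow_pos_of_pos hyn r
  have h1 : c₀ * ‖siteVec y‖ ^ (-r) ≤ a y := by
    rw [Real.rpow_neg hyn.le, ← div_eq_mul_inv, div_le_iff₀ hpow]
    exact hay
  have h2 : ((L : ℝ) * (M + 4)) ^ (-r) ≤ ‖siteVec y‖ ^ (-r) :=
    Real.rpow_le_rpow_of_nonpos hyn hn2 (by linarith)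
  calc c₀ * ((M : ℝ) + 4) ^ (-r) * (L : ℝ) ^ (-r) = c₀ * (((L : ℝ) * (M + 4)) ^ (-r)) := by
        rw [Real.mul_rpow hLpos.le (by positivity)]; ring
    _ ≤ c₀ * ‖siteVec y‖ ^ (-r) := mul_le_mul_of_nonneg_left h2 hc₀pos.le
    _ ≤ a y := h1

/-- The sup norm of a lattice site is at most the Euclidean norm of its embedding. -/
theorem norm_le_norm_siteVec (x : Site 3) : ‖x‖ ≤ ‖siteVec x‖ := by
  refine (pi_norm_le_iff_of_nonneg (norm_nonneg _)).2 fun i => ?_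
  rw [Int.norm_eq_abs, EuclideanSpace.norm_eq]
  refine Real.abs_le_sqrt ?_
  have h1 : ‖(siteVec x) i‖ ^ 2 ≤ ∑ j, ‖(siteVec x) j‖ ^ 2 :=
    Finset.single_le_sum (f := fun j => ‖(siteVec x) j‖ ^ 2) (fun j _ => sq_nonneg _) (Finset.mem_univ i)
  have h2 : ‖(siteVec x) i‖ ^ 2 = ((x i : ℤ) : ℝ) ^ 2 := by
    rw [siteVec_apply, Real.norm_eq_abs, sq_abs]
  rwa [h2] at h1

/-- **Upper envelope from the TAIL profile** (`d = 3`).  If `a(x)‖x‖₂^r − Φ(x̂) → 0` with `Φ`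
continuous on the unit sphere and `r ≥ 0`, then `a(x) ≤ C ‖x‖_∞^{-r}` for all `x ≠ 0`, for some
`C ≥ 0`. -/
theorem upper_of_profile {a : Site 3 → ℝ} {r : ℝ} (hr : 0 ≤ r) {Φ : EuclideanSpace ℝ (Fin 3) → ℝ}
    (hΦc : ContinuousOn Φ (Metric.sphere 0 1))
    (hT : Tendsto (fun x : Site 3 => a x * ‖siteVec x‖ ^ r - Φ (‖siteVec x‖⁻¹ • siteVec x))
      cofinite (𝓝 0)) :
    ∃ C : ℝ, 0 ≤ C ∧ ∀ x : Site 3, x ≠ 0 → a x ≤ C * ‖x‖ ^ (-r) := by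
  -- `Φ` is bounded on the sphere
  obtain ⟨B, hB⟩ : ∃ B : ℝ, ∀ u ∈ Metric.sphere (0 : EuclideanSpace ℝ (Fin 3)) 1, Φ u ≤ B := by
    obtain ⟨B, hB⟩ := (isCompact_sphere (0 : EuclideanSpace ℝ (Fin 3)) 1).bddAbove_image hΦc
    exact ⟨B, fun u hu => hB (Set.mem_image_of_mem Φ hu)⟩
  -- eventually `a x ‖x‖₂^r ≤ B + 1`
  have hev : ∀ᶠ x : Site 3 in cofinite, a x * ‖siteVec x‖ ^ r ≤ B + 1 := by
    have h1 := hT.eventually (Metric.ball_mem_nhds (0 : ℝ) one_pos)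
    filter_upwards [h1, eventually_cofinite_ne (0 : Site 3)] with x hx hx0
    have hxn : 0 < ‖siteVec x‖ := norm_pos_iff.2 fun h => hx0 ((siteVec_eq_zero_iff x).1 h)
    have hs : ‖siteVec x‖⁻¹ • siteVec x ∈ Metric.sphere (0 : EuclideanSpace ℝ (Fin 3)) 1 := by
      simp [norm_smul, hxn.ne']
    have := hB _ hs
    rw [Real.dist_eq, sub_zero] at hx
    have := (abs_lt.1 hx).2
    linarith
  -- the finitely many exceptions
  have hfin : Set.Finite {x : Site 3 | ¬ (a x * ‖siteVec x‖ ^ r ≤ B + 1)} := Filter.eventually_cofinite.1 hev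
  obtain ⟨B', hB'⟩ := (hfin.image fun x => a x * ‖siteVec x‖ ^ r).bddAbove
  refine ⟨max (max (B + 1) B') 0, le_max_right _ _, fun x hx0 => ?_⟩
  have hxn : 0 < ‖siteVec x‖ := norm_pos_iff.2 fun h => hx0 ((siteVec_eq_zero_iff x).1 h)
  have hxn' : 0 < ‖x‖ := norm_pos_iff.2 hx0
  have hbound : a x * ‖siteVec x‖ ^ r ≤ max (max (B + 1) B') 0 := by
    refine le_trans ?_ (le_max_left _ _)
    by_cases h : a x * ‖siteVec x‖ ^ r ≤ B + 1
    · exact h.trans (le_max_left _ _)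
    · exact (hB' (Set.mem_image_of_mem _ (show x ∈ {x : Site 3 | _} from h))).trans (le_max_right _ _)
  have hpow : 0 < ‖siteVec x‖ ^ r := Real.rpow_pos_of_pos hxn r
  have h1 : a x ≤ max (max (B + 1) B') 0 * ‖siteVec x‖ ^ (-r) := by
    rw [Real.rpow_neg hxn.le, ← div_eq_mul_inv, le_div_iff₀ hpow]
    exact hbound
  have h2 : ‖siteVec x‖ ^ (-r) ≤ ‖x‖ ^ (-r) :=
    Real.rpow_le_rpow_of_nonpos hxn' (norm_le_norm_siteVec x) (by linarith)
  exact h1.trans (mul_le_mul_of_nonneg_left h2 (le_max_right _ _))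

end HeavyBoxes

end Summit.CriticalPhenomena.Ising3DConformalLimit.Theorems.SpineGlue

end
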